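import Literature.Geometry.Lorentzian.KerrBoyerLindquistNormal
import Literature.Geometry.Lorentzian.KerrBoyerLindquistSliceExtrinsic
import HarnessLib

/-!
# The Boyer–Lindquist slice of Kerr as a map from quasi-isotropic Cartesian coordinates, VI:
# the closed form of the second fundamental form

Continuing `KerrBoyerLindquistNormal.lean` and `KerrBoyerLindquistSliceExtrinsic.lean`. The second
fundamental form of the Boyer–Lindquist leaf in quasi-isotropic Cartesian coordinates `y` is the
smooth bilinear-form-valued map

  `k_y = α(y)⁻¹ (k₁(y) (dR ⊗ ϖ + ϖ ⊗ dR) + k₂(y) (dμ ⊗ ϖ + ϖ ⊗ dμ))`   (`kRepCLM`),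

`dR = (q/ρ)⟨y, ·⟩/ρ` the differential of the quasi-isotropic radius `R(‖y‖)`, `dμ` that of
`μ = y₃/ρ`, `ϖ = (y₁dy₂ − y₂dy₁)/ρ²` the rotational form, `α` the lapse and `k₁, k₂` the
coefficient functions of `…SliceExtrinsic.lean` read at `(R(‖y‖), μ)` (`kOne`, `kTwo`). It is
smooth beyond the threshold, AXIS INCLUDED (`contDiffAt_kRepCLM`; `sin²θ dφ_BL = ϖ` absorbs the
axis singularity of `dφ_BL`), symmetric (`kRepCLM_symm`), and off the axis it is the coordinate
closed form transported along the coordinate section (`lapse_inv_mul_blK0_eq_kRepCLM`: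
`α⁻¹ K₀(dσ v, dσ w) = k_y(v, w)`). The identification with the second fundamental form of the
leaf is the business of the sequel.

References: Brandt–Seidel, Phys. Rev. D 52 (1995) 856, (9); Phys. Rev. D 54 (1996) 1403, §II;
Bardeen–Press–Teukolsky 1972, (2.3)–(2.5); Wald 1984, (10.2.13).
-/

noncomputable section

-- instance search through the nested operator types `E3 →L[ℝ] E3 →L[ℝ] ℝ`
set_option maxSynthPendingDepth 3

open Bundle TopologicalSpace Set Module Real Filter
open scoped InnerProductSpace Topology ContDiff Manifold

namespace Literature.Geometry.Lorentzian

namespace Kerr.BL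

open Kerr.Ingoing

variable {M a b : ℝ}

/-! ### The coefficient functions on `E3` -/

/-- `k₁(y) = −Ma(Σ(R² − a²) + 2R²(R² + a²))/(AΣ)` at `(R(‖y‖), μ = y₃/‖y‖)`. [cite: BrandtSeidel1996, §II] -/
def kOne (M a : ℝ) (y : E3) : ℝ :=
  -(M * a * (sigmaE M a y * (qiRadius M a ‖y‖ ^ 2 - a ^ 2) +
      2 * qiRadius M a ‖y‖ ^ 2 * (qiRadius M a ‖y‖ ^ 2 + a ^ 2))) / (bigA M a y * sigmaE M a y)

/-- `k₂(y) = −2MRa³μΔ(R)/(AΣ)` at `(R(‖y‖), μ = y₃/‖y‖)`. [cite: BrandtSeidel1996, §II] -/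
def kTwo (M a : ℝ) (y : E3) : ℝ :=
  -(2 * M * qiRadius M a ‖y‖ * a ^ 3 * (y 2 / ‖y‖) * Ingoing.delta M a (qiRadius M a ‖y‖)) /
    (bigA M a y * sigmaE M a y)

section Bridge

variable {u : E4} {y : E3}

/-- Bridge: `k₁`. [cite: BrandtSeidel1996, §II] -/
theorem blKrp_eq_kOne (h1 : u 1 = qiRadius M a ‖y‖) (h2 : u 2 = y 2 / ‖y‖) :
    blKrp M a u = kOne M a y := by
  simp only [blKrp, kOne, blA_eq_bigA h1 h2, sigma_eq_sigmaE h1 h2, h1]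

/-- Bridge: `k₂`. [cite: BrandtSeidel1996, §II] -/
theorem blKmp_eq_kTwo (h1 : u 1 = qiRadius M a ‖y‖) (h2 : u 2 = y 2 / ‖y‖) :
    blKmp M a u = kTwo M a y := by
  simp only [blKmp, kTwo, blA_eq_bigA h1 h2, sigma_eq_sigmaE h1 h2, h1, h2]

end Bridge

/-! ### The rotational form as a covector and the closed form -/

/-- The rotational form `ϖ_y = (y₁dy₂ − y₂dy₁)/ρ²` as a covector. [cite: BrandtSeidel1996, §II] -/
def rotFormCLM (y : E3) : E3 →L[ℝ] ℝ :=
  (‖y‖ ^ 2)⁻¹ • (y 0 • (EuclideanSpace.proj 1 : E3 →L[ℝ] ℝ) - y 1 • (EuclideanSpace.proj 0 : E3 →L[ℝ] ℝ))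

/-- `ϖ_y(v) = rotForm y v`. [cite: BrandtSeidel1996, §II] -/
@[simp] theorem rotFormCLM_apply (y v : E3) : rotFormCLM y v = rotForm y v := by
  simp [rotFormCLM, rotForm, div_eq_inv_mul]

variable (M a) in
/-- **The second fundamental form of the Boyer–Lindquist leaf in quasi-isotropic Cartesian
coordinates** (closed form): `k_y = α⁻¹ (k₁ (dR ⊗ ϖ + ϖ ⊗ dR) + k₂ (dμ ⊗ ϖ + ϖ ⊗ dμ))`.
Brandt–Seidel 1995, (9); 1996, §II. [cite: BrandtSeidel1996, §II] -/
def kRepCLM (y : E3) : E3 →L[ℝ] E3 →L[ℝ] ℝ :=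
  (lapseE M a y)⁻¹ •
    (kOne M a y • ((dRCLM M a y).smulRight (rotFormCLM y) + (rotFormCLM y).smulRight (dRCLM M a y)) +
      kTwo M a y • ((dMuCLM y).smulRight (rotFormCLM y) + (rotFormCLM y).smulRight (dMuCLM y)))

/-- The closed form evaluated (`y ≠ 0`). [cite: BrandtSeidel1996, §II] -/
theorem kRepCLM_apply {y : E3} (hy : y ≠ 0) (v w : E3) :
    kRepCLM M a y v w =
      (lapseE M a y)⁻¹ *
        (kOne M a y * (qiRoot M a ‖y‖ / ‖y‖ * (⟪y, v⟫_ℝ / ‖y‖) * rotForm y w +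
            rotForm y v * (qiRoot M a ‖y‖ / ‖y‖ * (⟪y, w⟫_ℝ / ‖y‖))) +
          kTwo M a y * (dMu y v * rotForm y w + rotForm y v * dMu y w)) := by
  simp only [kRepCLM, smul_apply, add_apply, ContinuousLinearMap.smulRight_apply, smul_eq_mul,
    rotFormCLM_apply, dRCLM_apply, dMuCLM_apply hy]

/-- **The closed form is symmetric.** [cite: BrandtSeidel1996, §II] -/
theorem kRepCLM_symm (y v w : E3) : kRepCLM M a y v w = kRepCLM M a y w v := by
  simp only [kRepCLM, smul_apply, add_apply, ContinuousLinearMap.smulRight_apply, smul_eq_mul]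
  ring

/-! ### Off the axis: the closed form is the transported coordinate form -/

/-- `sin²θ dφ_BL = ϖ`: `(1 − y₃²/ρ²) dPhi = rotForm` off the axis (`x₁² + x₂² = ρ² − x₃²`).
[cite: BrandtSeidel1996, §II] -/
theorem sinSq_mul_dPhi {x : E3} (hx : x 0 ≠ 0 ∨ x 1 ≠ 0) (v : E3) :
    (1 - (x 2 / ‖x‖) ^ 2) * dPhi x v = rotForm x v := by
  have hx0 : x ≠ 0 := ne_zero_of_offAxis hx
  have hρ : ‖x‖ ≠ 0 := norm_ne_zero_iff.2 hx0
  have hn := EuclideanSpace.real_norm_sq_eq x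
  rw [Fin.sum_univ_three] at hn
  have hn' : x 0 ^ 2 + x 1 ^ 2 = ‖x‖ ^ 2 - x 2 ^ 2 := by rw [hn]; ring
  have hden : ‖x‖ ^ 2 - x 2 ^ 2 ≠ 0 := by rw [← hn']; exact sq_add_sq_ne_zero_of_offAxis hx
  unfold dPhi rotForm
  rw [hn']
  field_simp

/-- **Off the axis, `α⁻¹ K₀(dσ v, dσ w) = k_x(v, w)`**: the coordinate closed form of
`…SliceExtrinsic.lean`, transported along the differential of the coordinate section
(`coordSectionDeriv_apply`), is the Cartesian closed form (`0 ≤ M`, `‖x‖ > ρH`, `R > max r₀ 0`).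
[cite: BrandtSeidel1996, §II] -/
theorem lapse_inv_mul_blK0_eq_kRepCLM (hM : 0 ≤ M) {r₀ : ℝ} {x : E3} (hρ : rhoH M a < ‖x‖)
    (hx : x 0 ≠ 0 ∨ x 1 ≠ 0) (hR : max r₀ 0 < qiRadius M a ‖x‖) (v w : E3) :
    (blLapse M a (coordSection M a b x x))⁻¹ *
        blK0 M a (coordSection M a b x x) (coordSectionDeriv M a x v) (coordSectionDeriv M a x w) =
      kRepCLM M a x v w := by
  have hmem : coordSection M a b x x ∈ coordDomain r₀ := coordSection_mem_coordDomain hx hR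
  have hx0 : x ≠ 0 := ne_zero_of_offAxis hx
  obtain ⟨hΔ, hS, hA⟩ := coordSection_pos (b := b) hM hρ hx hR
  have hs : sinSq (coordSection M a b x x) ≠ 0 := sinSq_ne_zero hmem
  have h1 : coordSection M a b x x 1 = qiRadius M a ‖x‖ := rfl
  have h2 : coordSection M a b x x 2 = x 2 / ‖x‖ := rfl
  have hs' : sinSq (coordSection M a b x x) = 1 - (x 2 / ‖x‖) ^ 2 := rfl
  rw [coordSectionDeriv_apply hx v, coordSectionDeriv_apply hx w,
    show qiRadius M a ‖x‖ = coordSection M a b x x 1 from rfl,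
    blK0_blLift_blLift hΔ.ne' hS.ne' hA.ne' hs, blKrp_eq_kOne h1 h2, blKmp_eq_kTwo h1 h2,
    blLapse_eq_lapseE h1 h2, kRepCLM_apply hx0, ← sinSq_mul_dPhi hx v, ← sinSq_mul_dPhi hx w, hs']
  ring

/-! ### Smoothness of the closed form beyond the threshold -/

section Smooth

/-- `y ↦ (φ y) ⊗ (ψ y)` is smooth when `φ, ψ` are (stated for a general normed target so that
instance search at the use site is canonical). [folklore] -/
theorem contDiffAt_smulRight' {V W F : Type*} [NormedAddCommGroup V] [NormedSpace ℝ V]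
    [NormedAddCommGroup W] [NormedSpace ℝ W] [NormedAddCommGroup F] [NormedSpace ℝ F]
    {φ : V → W →L[ℝ] ℝ} {ψ : V → F} {y : V} {n : WithTop ℕ∞} (hφ : ContDiffAt ℝ n φ y)
    (hψ : ContDiffAt ℝ n ψ y) : ContDiffAt ℝ n (fun y ↦ (φ y).smulRight (ψ y)) y :=
  (isBoundedBilinearMap_smulRight (𝕜 := ℝ) (E := W) (F := F)).contDiff.contDiffAt.comp y
    (hφ.prodMk hψ)

/-- A `C^n` scalar function times a `C^n` vector function is `C^n` (general normed target, so
that instance search at the use site `F = (E3 →L E3 →L ℝ)` is canonical). [folklore] -/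
theorem contDiffAt_smul' {V F : Type*} [NormedAddCommGroup V] [NormedSpace ℝ V]
    [NormedAddCommGroup F] [NormedSpace ℝ F] {f : V → ℝ} {g : V → F} {y : V} {n : WithTop ℕ∞}
    (hf : ContDiffAt ℝ n f y) (hg : ContDiffAt ℝ n g y) : ContDiffAt ℝ n (fun y ↦ f y • g y) y :=
  hf.smul hg

/-- Sums of `C^n` vector functions are `C^n` (general normed target). [folklore] -/
theorem contDiffAt_add' {V F : Type*} [NormedAddCommGroup V] [NormedSpace ℝ V]
    [NormedAddCommGroup F] [NormedSpace ℝ F] {f g : V → F} {y : V} {n : WithTop ℕ∞}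
    (hf : ContDiffAt ℝ n f y) (hg : ContDiffAt ℝ n g y) : ContDiffAt ℝ n (fun y ↦ f y + g y) y :=
  hf.add hg

/-- `q(ρ) = ρ − (M² − a²)/(4ρ)` is smooth in `ρ = ‖y‖` off the origin. [cite: BrandtSeidel1996, §II] -/
theorem contDiffAt_qiRoot_norm {y : E3} (hy : y ≠ 0) {n : WithTop ℕ∞} :
    ContDiffAt ℝ n (fun y : E3 ↦ qiRoot M a ‖y‖) y := by
  have hn : ContDiffAt ℝ n (fun y : E3 ↦ ‖y‖) y := contDiffAt_norm ℝ hy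
  unfold qiRoot
  exact hn.sub (contDiffAt_const.div (contDiffAt_const.mul hn)
    (mul_ne_zero four_ne_zero (norm_ne_zero_iff.2 hy)))

/-- `dR` is smooth off the origin. [cite: BrandtSeidel1996, §II] -/
theorem contDiffAt_dRCLM {y : E3} (hy : y ≠ 0) : ContDiffAt ℝ ∞ (fun y : E3 ↦ dRCLM M a y) y := by
  have hρ : ‖y‖ ≠ 0 := norm_ne_zero_iff.2 hy
  have hn : ContDiffAt ℝ ∞ (fun y : E3 ↦ ‖y‖) y := contDiffAt_norm ℝ hy
  have hc : ContDiffAt ℝ ∞ (fun y : E3 ↦ E3.covec y) y :=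
    (innerSL ℝ (E := E3) : E3 →L[ℝ] E3 →L[ℝ] ℝ).contDiff.contDiffAt
  unfold dRCLM
  exact (((contDiffAt_qiRoot_norm hy).div hn hρ).mul (hn.inv hρ)).smul hc

/-- `ϖ` is smooth off the origin. [cite: BrandtSeidel1996, §II] -/
theorem contDiffAt_rotFormCLM {y : E3} (hy : y ≠ 0) : ContDiffAt ℝ ∞ rotFormCLM y := by
  have hρ : ‖y‖ ≠ 0 := norm_ne_zero_iff.2 hy
  have hn : ContDiffAt ℝ ∞ (fun y : E3 ↦ ‖y‖) y := contDiffAt_norm ℝ hy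
  have h0 : ContDiffAt ℝ ∞ (fun y : E3 ↦ y 0) y :=
    (EuclideanSpace.proj (𝕜 := ℝ) (0 : Fin 3)).contDiff.contDiffAt
  have h1 : ContDiffAt ℝ ∞ (fun y : E3 ↦ y 1) y :=
    (EuclideanSpace.proj (𝕜 := ℝ) (1 : Fin 3)).contDiff.contDiffAt
  unfold rotFormCLM
  exact ((hn.pow 2).inv (pow_ne_zero 2 hρ)).smul
    ((h0.smul contDiffAt_const).sub (h1.smul contDiffAt_const))

/-- `dμ` is smooth off the origin. [folklore] -/
theorem contDiffAt_dMuCLM {y : E3} (hy : y ≠ 0) : ContDiffAt ℝ ∞ dMuCLM y := by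
  have hρ : ‖y‖ ≠ 0 := norm_ne_zero_iff.2 hy
  have hn : ContDiffAt ℝ ∞ (fun y : E3 ↦ ‖y‖) y := contDiffAt_norm ℝ hy
  have h2 : ContDiffAt ℝ ∞ (fun y : E3 ↦ y 2) y :=
    (EuclideanSpace.proj (𝕜 := ℝ) (2 : Fin 3)).contDiff.contDiffAt
  have hc : ContDiffAt ℝ ∞ (fun y : E3 ↦ E3.covec y) y :=
    (innerSL ℝ (E := E3) : E3 →L[ℝ] E3 →L[ℝ] ℝ).contDiff.contDiffAt
  unfold dMuCLM
  exact ((hn.inv hρ).smul contDiffAt_const).sub ((h2.div (hn.pow 3) (pow_ne_zero 3 hρ)).smul hc)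

/-- `k₁` is smooth beyond the threshold (`0 ≤ M`). [cite: BrandtSeidel1996, §II] -/
theorem contDiffAt_kOne (hM : 0 ≤ M) {y : E3} (hy : rhoH M a < ‖y‖) : ContDiffAt ℝ ∞ (kOne M a) y := by
  have hy0 : y ≠ 0 := by
    intro h0; rw [h0, norm_zero] at hy; exact absurd hy (not_lt.2 (rhoH_nonneg M a))
  have hR := contDiffAt_qiRadius_norm M a hy0 (n := ∞)
  have hS := contDiffAt_sigmaE (M := M) (a := a) hy0 (n := ∞)
  unfold kOne
  exact ((contDiffAt_const.mul ((hS.mul ((hR.pow 2).sub contDiffAt_const)).add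
    ((contDiffAt_const.mul (hR.pow 2)).mul ((hR.pow 2).add contDiffAt_const)))).neg).div
    ((contDiffAt_bigA hy0).mul hS) (mul_ne_zero (bigA_pos hM hy).ne' (sigmaE_pos hM hy).ne')

/-- `k₂` is smooth beyond the threshold (`0 ≤ M`). [cite: BrandtSeidel1996, §II] -/
theorem contDiffAt_kTwo (hM : 0 ≤ M) {y : E3} (hy : rhoH M a < ‖y‖) : ContDiffAt ℝ ∞ (kTwo M a) y := by
  have hy0 : y ≠ 0 := by
    intro h0; rw [h0, norm_zero] at hy; exact absurd hy (not_lt.2 (rhoH_nonneg M a))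
  have hR := contDiffAt_qiRadius_norm M a hy0 (n := ∞)
  have hS := contDiffAt_sigmaE (M := M) (a := a) hy0 (n := ∞)
  have hΔ : ContDiffAt ℝ ∞ (fun y : E3 ↦ Ingoing.delta M a (qiRadius M a ‖y‖)) y := by
    simp only [Ingoing.delta]
    exact ((hR.pow 2).sub (contDiffAt_const.mul hR)).add contDiffAt_const
  unfold kTwo
  exact (((((contDiffAt_const.mul hR).mul contDiffAt_const).mul (contDiffAt_div_norm hy0)).mul
    hΔ).neg).div ((contDiffAt_bigA hy0).mul hS)
    (mul_ne_zero (bigA_pos hM hy).ne' (sigmaE_pos hM hy).ne')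

/-- **The closed form is smooth beyond the threshold, axis included** (`0 ≤ M`).
[cite: BrandtSeidel1996, §II] -/
theorem contDiffAt_kRepCLM (hM : 0 ≤ M) {y : E3} (hy : rhoH M a < ‖y‖) :
    ContDiffAt ℝ ∞ (kRepCLM M a) y := by
  have hy0 : y ≠ 0 := by
    intro h0; rw [h0, norm_zero] at hy; exact absurd hy (not_lt.2 (rhoH_nonneg M a))
  have hdR := contDiffAt_dRCLM (M := M) (a := a) hy0
  have hrot := contDiffAt_rotFormCLM hy0
  have hdM := contDiffAt_dMuCLM hy0
  unfold kRepCLM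
  exact contDiffAt_smul' (F := E3 →L[ℝ] E3 →L[ℝ] ℝ)
    ((contDiffAt_lapseE hM hy).inv (lapseE_pos hM hy).ne')
    (contDiffAt_add' (F := E3 →L[ℝ] E3 →L[ℝ] ℝ)
      (contDiffAt_smul' (F := E3 →L[ℝ] E3 →L[ℝ] ℝ) (contDiffAt_kOne hM hy)
        (contDiffAt_add' (F := E3 →L[ℝ] E3 →L[ℝ] ℝ) (contDiffAt_smulRight' hdR hrot)
          (contDiffAt_smulRight' hrot hdR)))
      (contDiffAt_smul' (F := E3 →L[ℝ] E3 →L[ℝ] ℝ) (contDiffAt_kTwo hM hy)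
        (contDiffAt_add' (F := E3 →L[ℝ] E3 →L[ℝ] ℝ) (contDiffAt_smulRight' hdM hrot)
          (contDiffAt_smulRight' hrot hdM))))

end Smooth

end Kerr.BL

end Literature.Geometry.Lorentzian

end
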